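import Literature.Analysis.FluidPDE.OkamotoSakajoWunsch2008.HilbertTransformAnalytic
import HarnessLib

/-!
# OSW separable blow-up, read in real variables: the cell's corollary with the ANALYTIC Hilbert transform

HONEST FRAMING (cells pub-oswblow / ns-blowup; 1-D MODEL (gCLM/OSW on the circle), computer-assisted context; not Euler/NS).

`SeparableBlowup.lean` states the cell's corollary `BlowupFromAnalyticData lo hi` («finite-time blow-up of the Okamoto–Sakajo–Wunsch
equation from real-analytic odd data at some `a ∈ [lo, hi]`») on the FOURIER SIDE: a family of coefficient sequences `C t` forming an
`IsClassicalSolution a C T` whose series diverges at a point as `t ↑ T`. With `HilbertTransformAnalytic.lean` (the multiplier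
`hilbertCoeff` IS the p.v. operator `hilbertTransformCircle` on the class in question) this file gives the same statement in CLASSICAL
REAL VARIABLES (`blowupFromAnalyticData_real`): real functions `ω, ω_x, v : ℝ → ℝ → ℝ` on `t < T` with `ω(t, ·)` `2π`-periodic and `C¹`
(`∂ₓω = ω_x`), `∂ₓv = H[ω(t,·)]`, the OSW equation `∂ₜω = −a·v·ω_x + ω·H[ω(t,·)]` [OkamotoSakajoWunsch2008, eq. (3)] holding pointwise with
`H = hilbertTransformCircle`, odd initial datum, and `|ω(t, x₀)| → ∞` as `t ↑ T` at some point `x₀`. Hence the cell's typed implication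
`osw_blowup_from_analytic_data` reads, verbatim, as blow-up of the OSW equation with the genuine Hilbert transform (`osw_blowup_real_of_A3`).
No definition, no named fact; nothing is asserted unconditionally (the target `AnalyticSeparableProfileA3` stays a hypothesis).
-/

noncomputable section

namespace Summit.NavierStokesRegularity.OSWSelfSimilar
namespace OSWBlowupReal

open _root_.Set _root_.Filter
open Literature.Analysis.Fourier Literature.Analysis.FluidPDE.OkamotoSakajoWunsch2008
open scoped Real Topology

/-- **Blow-up from analytic data, in real variables.** `BlowupFromAnalyticData lo hi` (Fourier-side) yields a parameter `a ∈ [lo, hi]`,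
a time `T > 0` and real functions `ω, ωₓ, v : ℝ → ℝ → ℝ` (time first) such that for every `t < T`: `ω(t,·)` is `2π`-periodic and
differentiable with `∂ₓ ω(t,·) = ωₓ(t,·)`, `∂ₓ v(t,·) = H[ω(t,·)]` with `H = hilbertTransformCircle` (OSW's `v_x = Hω`), and the OSW equation
`∂ₜ ω(t,x) = −a·v(t,x)·ωₓ(t,x) + ω(t,x)·H[ω(t,·)](x)` holds at every `x`; the datum `ω(0,·)` is odd; and `|ω(t,x₀)| → ∞` as `t ↑ T` at some
`x₀`. [folklore] -/
theorem blowupFromAnalyticData_real {lo hi : ℝ} (h : BlowupFromAnalyticData lo hi) :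
    ∃ a : ℝ, lo ≤ a ∧ a ≤ hi ∧ ∃ T : ℝ, 0 < T ∧ ∃ ω ωx v : ℝ → ℝ → ℝ,
      (∀ t : ℝ, t < T → ∀ x : ℝ, ω t (x + 2 * π) = ω t x) ∧
      (∀ t : ℝ, t < T → ∀ x : ℝ, HasDerivAt (ω t) (ωx t x) x) ∧
      (∀ t : ℝ, t < T → ∀ x : ℝ, HasDerivAt (v t) (hilbertTransformCircle (ω t) x) x) ∧
      (∀ t : ℝ, t < T → ∀ x : ℝ,
        HasDerivAt (fun s => ω s x) (-a * v t x * ωx t x + ω t x * hilbertTransformCircle (ω t) x) t) ∧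
      (∀ x : ℝ, ω 0 (-x) = -ω 0 x) ∧
      ∃ x₀ : ℝ, Tendsto (fun t => |ω t x₀|) (𝓝[<] T) atTop := by
  obtain ⟨a, hlo, hhi, T, hT, C, hsol, hodd0, x₀, hblow⟩ := h
  refine ⟨a, hlo, hhi, T, hT, fun t x => (fourierEval (C t) x).re, fun t x => (fourierEval (derivCoeff (C t)) x).re,
    fun t x => (velocityEval (C t) x).re, ?_, ?_, ?_, ?_, ?_, x₀, ?_⟩
  · intro t _ x
    simp only [fourierEval_add_two_pi]
  · intro t ht x
    obtain ⟨⟨ρ, K, hdec⟩, _⟩ := hsol.1 t ht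
    exact hasDerivAt_fourierEval_re hdec x
  · intro t ht x
    obtain ⟨⟨ρ, K, hdec⟩, hre⟩ := hsol.1 t ht
    exact hasDerivAt_velocityEval_re hdec hre x
  · intro t ht x
    exact hasDerivAt_re_of_isClassicalSolution hsol x t ht
  · intro x
    simp only [fourierEval_neg_of_isOddSeq hodd0, Complex.neg_re]
  · -- the series is real for `t < T`, so `|Re ω| = ‖ω‖` there
    refine (hblow.congr' ?_)
    filter_upwards [self_mem_nhdsWithin] with t ht
    have him : (fourierEval (C t) x₀).im = 0 := fourierEval_im_of_isRealSeq (hsol.1 t ht).2 x₀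
    rw [← Complex.abs_re_eq_norm.mpr him]

/-- **The cell's corollary, read with the analytic operator.** The typed target `AnalyticSeparableProfileA3` of cell pub-oswblow implies
finite-time blow-up, in the classical real sense above, of the Okamoto–Sakajo–Wunsch equation with the p.v. Hilbert transform, from odd
`2π`-periodic data, at a parameter `a ∈ [0.755272287, 0.755272288]`. (Implication only; the target is delivered off-Lean by the cell's
certificate and is NOT asserted here.) [folklore] -/
theorem osw_blowup_real_of_A3 (h : AnalyticSeparableProfileA3) :
    ∃ a : ℝ, (0.755272287 : ℝ) ≤ a ∧ a ≤ 0.755272288 ∧ ∃ T : ℝ, 0 < T ∧ ∃ ω ωx v : ℝ → ℝ → ℝ,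
      (∀ t : ℝ, t < T → ∀ x : ℝ, ω t (x + 2 * π) = ω t x) ∧
      (∀ t : ℝ, t < T → ∀ x : ℝ, HasDerivAt (ω t) (ωx t x) x) ∧
      (∀ t : ℝ, t < T → ∀ x : ℝ, HasDerivAt (v t) (hilbertTransformCircle (ω t) x) x) ∧
      (∀ t : ℝ, t < T → ∀ x : ℝ,
        HasDerivAt (fun s => ω s x) (-a * v t x * ωx t x + ω t x * hilbertTransformCircle (ω t) x) t) ∧
      (∀ x : ℝ, ω 0 (-x) = -ω 0 x) ∧
      ∃ x₀ : ℝ, Tendsto (fun t => |ω t x₀|) (𝓝[<] T) atTop :=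
  blowupFromAnalyticData_real (osw_blowup_from_analytic_data h)

end OSWBlowupReal
end Summit.NavierStokesRegularity.OSWSelfSimilar

end
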